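import Mathlib
import Literature.MathematicalPhysics.QuantumManyBody.BoseEinsteinCondensation
import Summits.AtomisticToContinuum.BoseEinsteinCondensation.Theorems.SoloBlindBhattacharyya
import Summits.AtomisticToContinuum.BoseEinsteinCondensation.Theorems.SoloBlindMutualInformation

/-!
# The affinity criterion is effective: plateau amplitudes condense uniformly in `N`

Solo seat `solo-AtomisticToContinuum-blind`, conjunct `BoseEinsteinCondensation`.

A first **`N`-uniform rung** for the affinity criterion.  Let `S ⊆ Space` have finite positive
volume (the one-particle box) and let `Φ ≥ 0` be an `(n+1)`-particle amplitude supported in `S` in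
its first particle such that, for every configuration `Y` of the other `n` particles, the
conditional amplitude `x ↦ Φ (x :: Y)` is bounded by `F Y` and *equals* `F Y` off an exceptional set
`E Y` of volume `≤ η · volume S`.  Then the uniform mode on `S` is occupied by at least
`(n+1) · (1 − η)²` particles (`mul_sq_le_maxOccupation_of_plateau`): the participation ratio of the
conditional amplitude is `≥ 1 − η` for **every** `Y`, hence the Bhattacharyya affinity to the
uniform resampling is `≥ 1 − η`, and the kernel-checked sandwich applies.

The motivating instance (`mul_sq_le_maxOccupation_of_plateau_off_balls`) is `E Y = ⋃ⱼ B(Yⱼ, R)`: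
every `[0,1]`-valued finite-range **Jastrow amplitude** `Ψ_J = ∏_{i<j} f(xᵢ − xⱼ)`, `f = 1` outside
range `R` (e.g. the hard-sphere factor), restricted to a box `S`, has this form, so
`λ_max(γ_{Ψ_J}) ≥ maxOccupation ≥ (n+1)(1 − n·|B_R|/|S|)²` for every `n` — Penrose–Onsager's
free-volume picture with a rigorous floor from the union bound.  The true ground state is *not* of
this form; what it adds (the long-range phonon deformation) is exactly the open part of the problem.
-/

open MeasureTheory
open scoped ENNReal

namespace Summit.AtomisticToContinuum.BoseEinsteinCondensation.Theorems

open Literature.MathematicalPhysics.QuantumManyBody.BoseGas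

/-- **Plateau amplitudes condense.** See the module docstring. The conclusion uses truncated
subtraction in `ℝ≥0∞` (it is trivial when `η ≥ 1`). -/
theorem mul_sq_le_maxOccupation_of_plateau {n : ℕ} {S : Set Space} (hS : MeasurableSet S)
    (hS0 : volume S ≠ 0) (hStop : volume S ≠ ⊤)
    {Φ : Config (n + 1) → ℝ} {F : Config n → ℝ} {E : Config n → Set Space}
    (hΦ0 : 0 ≤ Φ) (hΦm : Measurable Φ)
    (hΦ1 : ∫⁻ Y : Config n, ∫⁻ x, ENNReal.ofReal (Φ (Matrix.vecCons x Y)) ^ 2 = 1)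
    (hle : ∀ Y x, Φ (Matrix.vecCons x Y) ≤ F Y)
    (hsupp : ∀ Y x, x ∉ S → Φ (Matrix.vecCons x Y) = 0)
    (hEm : ∀ Y, MeasurableSet (E Y))
    (hplat : ∀ Y x, x ∈ S → x ∉ E Y → Φ (Matrix.vecCons x Y) = F Y)
    {η : ℝ≥0∞} (hE : ∀ Y, volume (E Y) ≤ η * volume S) :
    (n + 1 : ℝ≥0∞) * (1 - η) ^ 2 ≤ maxOccupation (n + 1) (fun X => (Φ X : ℂ)) := by
  -- the uniform mode on `S`
  set V : ℝ≥0∞ := volume S with hV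
  set c : ℝ := Real.sqrt (V.toReal)⁻¹ with hc
  have hc0 : 0 ≤ c := Real.sqrt_nonneg _
  have hVpos : 0 < V.toReal := ENNReal.toReal_pos hS0 hStop
  have hc2 : ENNReal.ofReal c ^ 2 = V⁻¹ := by
    rw [← ENNReal.ofReal_pow hc0, hc, Real.sq_sqrt (inv_nonneg.mpr hVpos.le),
      ENNReal.ofReal_inv_of_pos hVpos, ENNReal.ofReal_toReal hStop]
  set g : Space → ℝ := S.indicator fun _ => c with hg
  have hg0 : 0 ≤ g := fun x => by
    simp only [hg, Pi.zero_apply]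
    by_cases hx : x ∈ S
    · rw [Set.indicator_of_mem hx]; exact hc0
    · rw [Set.indicator_of_notMem hx]
  have hgm : Measurable g := measurable_const.indicator hS
  have hg_of : ∀ x, ENNReal.ofReal (g x) = S.indicator (fun _ => ENNReal.ofReal c) x := by
    intro x
    simp only [hg]
    by_cases hx : x ∈ S
    · rw [Set.indicator_of_mem hx, Set.indicator_of_mem hx]
    · rw [Set.indicator_of_notMem hx, Set.indicator_of_notMem hx, ENNReal.ofReal_zero]
  have hg1 : ∫⁻ x, ENNReal.ofReal (g x) ^ 2 = 1 := by
    have : (fun x => ENNReal.ofReal (g x) ^ 2) = S.indicator (fun _ => ENNReal.ofReal c ^ 2) := by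
      funext x
      rw [hg_of]
      by_cases hx : x ∈ S
      · rw [Set.indicator_of_mem hx, Set.indicator_of_mem hx]
      · rw [Set.indicator_of_notMem hx, Set.indicator_of_notMem hx, zero_pow two_ne_zero]
    rw [this, lintegral_indicator_const hS, hc2, ENNReal.inv_mul_cancel hS0 hStop]
  -- per-`Y` estimate: affinity integrand ≥ (1 - η) · conditional mass
  have hF0 : ∀ Y, 0 ≤ F Y := fun Y => (hΦ0 _).trans (hle Y 0)
  have hkey : ∀ Y : Config n,
      (1 - η) * ∫⁻ x, ENNReal.ofReal (Φ (Matrix.vecCons x Y)) ^ 2 ≤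
        (∫⁻ x, ENNReal.ofReal (g x) * ENNReal.ofReal (Φ (Matrix.vecCons x Y))) *
          (∫⁻ x, ENNReal.ofReal (Φ (Matrix.vecCons x Y)) ^ 2) ^ (1 / 2 : ℝ) := by
    intro Y
    set P : ℝ≥0∞ := ∫⁻ x, ENNReal.ofReal (Φ (Matrix.vecCons x Y)) ^ 2 with hP
    set f : ℝ≥0∞ := ENNReal.ofReal (F Y) with hf
    -- (a) `P ≤ f² V`
    have ha : P ≤ f ^ 2 * V := by
      calc P ≤ ∫⁻ x, S.indicator (fun _ => f ^ 2) x := by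
            refine lintegral_mono fun x => ?_
            by_cases hx : x ∈ S
            · rw [Set.indicator_of_mem hx]
              exact pow_le_pow_left' (ENNReal.ofReal_le_ofReal (hle Y x)) 2
            · rw [Set.indicator_of_notMem hx, hsupp Y x hx]
              simp
        _ = f ^ 2 * V := lintegral_indicator_const hS _
    -- (b) `∫ g Φ ≥ c f (1-η) V`
    have hb : ENNReal.ofReal c * f * ((1 - η) * V) ≤
        ∫⁻ x, ENNReal.ofReal (g x) * ENNReal.ofReal (Φ (Matrix.vecCons x Y)) := by
      have hdiff : (1 - η) * V ≤ volume (S \ E Y) := by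
        refine le_trans ?_ le_measure_sdiff
        rw [ENNReal.sub_mul (fun _ _ => hStop), one_mul]
        exact tsub_le_tsub_left (hE Y) _
      calc ENNReal.ofReal c * f * ((1 - η) * V)
          ≤ ENNReal.ofReal c * f * volume (S \ E Y) := mul_le_mul' le_rfl hdiff
        _ = ∫⁻ x, (S \ E Y).indicator (fun _ => ENNReal.ofReal c * f) x :=
            (lintegral_indicator_const (hS.diff (hEm Y)) _).symm
        _ ≤ _ := by
            refine lintegral_mono fun x => ?_
            by_cases hx : x ∈ S \ E Y
            · rw [Set.indicator_of_mem hx, hg_of, Set.indicator_of_mem hx.1, hplat Y x hx.1 hx.2]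
            · rw [Set.indicator_of_notMem hx]
              exact bot_le
    -- (c) `P^{1/2} ≤ c f V`
    have hcV : (ENNReal.ofReal c * f * V) ^ 2 = f ^ 2 * V := by
      rw [mul_pow, mul_pow, hc2, sq V, mul_assoc, mul_comm (f ^ 2), ← mul_assoc, ← mul_assoc,
        ENNReal.inv_mul_cancel hS0 hStop, one_mul, mul_comm]
    have hroot : P ^ (1 / 2 : ℝ) ≤ ENNReal.ofReal c * f * V := by
      have h1 : P ^ (1 / 2 : ℝ) ≤ ((ENNReal.ofReal c * f * V) ^ 2) ^ (1 / 2 : ℝ) :=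
        ENNReal.rpow_le_rpow (ha.trans_eq hcV.symm) (by norm_num)
      rwa [← ENNReal.rpow_two, ← ENNReal.rpow_mul, show (2 : ℝ) * (1 / 2) = 1 by norm_num,
        ENNReal.rpow_one] at h1
    -- combine: `(1-η) P = (1-η) P^{1/2} P^{1/2} ≤ (c f (1-η) V) P^{1/2} ≤ (∫ g Φ) P^{1/2}`
    have hPP : P = P ^ (1 / 2 : ℝ) * P ^ (1 / 2 : ℝ) := by
      rw [← ENNReal.rpow_add_of_nonneg _ _ (by norm_num) (by norm_num)]
      norm_num
    calc (1 - η) * P = ((1 - η) * P ^ (1 / 2 : ℝ)) * P ^ (1 / 2 : ℝ) := by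
          rw [mul_assoc, ← hPP]
      _ ≤ (ENNReal.ofReal c * f * ((1 - η) * V)) * P ^ (1 / 2 : ℝ) := by
          refine mul_le_mul' ?_ le_rfl
          calc (1 - η) * P ^ (1 / 2 : ℝ) ≤ (1 - η) * (ENNReal.ofReal c * f * V) :=
                mul_le_mul' le_rfl hroot
            _ = ENNReal.ofReal c * f * ((1 - η) * V) := by ring
      _ ≤ _ := mul_le_mul' hb le_rfl
  -- integrate in `Y`: affinity ≥ 1 - η
  have hmeasP : Measurable fun Y : Config n => ∫⁻ x, ENNReal.ofReal (Φ (Matrix.vecCons x Y)) ^ 2 :=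
    (((hΦm.comp measurable_vecCons).ennreal_ofReal).pow_const 2).lintegral_prod_left'
  have hBC : 1 - η ≤ ∫⁻ Y : Config n,
      (∫⁻ x, ENNReal.ofReal (g x) * ENNReal.ofReal (Φ (Matrix.vecCons x Y))) *
        (∫⁻ x, ENNReal.ofReal (Φ (Matrix.vecCons x Y)) ^ 2) ^ (1 / 2 : ℝ) := by
    calc 1 - η = (1 - η) * ∫⁻ Y : Config n, ∫⁻ x, ENNReal.ofReal (Φ (Matrix.vecCons x Y)) ^ 2 := by
          rw [hΦ1, mul_one]
      _ = ∫⁻ Y : Config n, (1 - η) * ∫⁻ x, ENNReal.ofReal (Φ (Matrix.vecCons x Y)) ^ 2 :=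
          (lintegral_const_mul _ hmeasP).symm
      _ ≤ _ := lintegral_mono fun Y => hkey Y
  -- sandwich
  have hsand := bhattacharyya_sq_le_maxOccupation' hg0 hΦ0 hgm hΦm hg1 hΦ1
  exact le_trans (mul_le_mul' le_rfl (pow_le_pow_left' hBC 2)) hsand

/-- **Jastrow-type instance: plateau off the `R`-balls around the other particles.** If the
conditional amplitude `x ↦ Φ (x :: Y)` is `≤ F Y`, vanishes off the box `S`, and equals `F Y` at
every `x ∈ S` with `dist x (Y j) ≥ R` for all `j`, then
`(n+1) · (1 − n·|B_R|/|S|)² ≤ maxOccupation (n+1) Φ` — uniformly in `n` at fixed density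
`n / |S|`. -/
theorem mul_sq_le_maxOccupation_of_plateau_off_balls {n : ℕ} {S : Set Space}
    (hS : MeasurableSet S) (hS0 : volume S ≠ 0) (hStop : volume S ≠ ⊤)
    {Φ : Config (n + 1) → ℝ} {F : Config n → ℝ} {R : ℝ}
    (hΦ0 : 0 ≤ Φ) (hΦm : Measurable Φ)
    (hΦ1 : ∫⁻ Y : Config n, ∫⁻ x, ENNReal.ofReal (Φ (Matrix.vecCons x Y)) ^ 2 = 1)
    (hle : ∀ Y x, Φ (Matrix.vecCons x Y) ≤ F Y)
    (hsupp : ∀ Y x, x ∉ S → Φ (Matrix.vecCons x Y) = 0)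
    (hplat : ∀ Y x, x ∈ S → (∀ j, R ≤ dist x (Y j)) → Φ (Matrix.vecCons x Y) = F Y) :
    (n + 1 : ℝ≥0∞) * (1 - n * volume (Metric.ball (0 : Space) R) / volume S) ^ 2 ≤
      maxOccupation (n + 1) (fun X => (Φ X : ℂ)) := by
  refine mul_sq_le_maxOccupation_of_plateau hS hS0 hStop hΦ0 hΦm hΦ1 hle hsupp
    (E := fun Y => ⋃ j : Fin n, Metric.ball (Y j) R)
    (fun Y => MeasurableSet.iUnion fun j => Metric.isOpen_ball.measurableSet) ?_ ?_
  · intro Y x hx hxE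
    refine hplat Y x hx fun j => ?_
    by_contra hlt
    exact hxE (Set.mem_iUnion.mpr ⟨j, Metric.mem_ball.mpr (by rw [dist_comm] at hlt ⊢; exact lt_of_not_ge hlt)⟩)
  · intro Y
    rw [ENNReal.div_mul_cancel hS0 hStop]
    calc volume (⋃ j : Fin n, Metric.ball (Y j) R)
        ≤ ∑ j : Fin n, volume (Metric.ball (Y j) R) := measure_iUnion_fintype_le _ _
      _ = ∑ _j : Fin n, volume (Metric.ball (0 : Space) R) := by
          refine Finset.sum_congr rfl fun j _ => ?_
          exact Measure.addHaar_ball_center volume (Y j) R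
      _ = n * volume (Metric.ball (0 : Space) R) := by
          rw [Finset.sum_const, Finset.card_univ, Fintype.card_fin, nsmul_eq_mul]

end Summit.AtomisticToContinuum.BoseEinsteinCondensation.Theorems
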